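import Summits.ResolutionOfSingularities.ResolutionOfSingularities.Theorems.PurelyInseparableDim4Perm2BoundOrigin
import HarnessLib

/-!
# [OURS · res-dim4-pi] TORUS × UNIT EQUIVARIANCE OF THE MODEL, part 1: the coordinate-centre step under the
  diagonal substitution `x ↦ λx` and under multiplication of `F` by a unit

Cell `res-dim4-pi` (D-0157 DOOR 2, wave 2), seat `res-dim4-p-6`; companion of `PurelyInseparableDim4Equivariance`
(S₄-equivariance).  The engines enumerate configurations in the normal form «`S₄ × scalings` reduced» (sweeps
S-2 / S-3 at `p = 3, 5`, coefficients `{1, 2}`); this file is the kernel statement that the torus half of that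
reduction is sound for every RELATION of record.  Typed over the TREE's `CentreBlowup.degIn / ordAlong /
chartExponent / chartTransform / pointTransform / newMult / newExc / step`, `PointBlowup.translate`,
`Hauser2010.deletePthPowers`, and p-2's origin dictionary (`Perm2Bound.degIn_eq_add_degIn_erase`).  The diagonal
substitution is written inline as `aeval (fun i => C (μ i) * X i)`; no definition is introduced.

## What is proved (any finite index type `σ`, any field `K`, any exponent `q`)

* §1 `scale_monomial`, `coeff_scale` (`coeff d (F(μx)) = μ^d · coeff d F`), `support_scale` / `ordAlong_scale`
  (units), `support_C_mul` / `ordAlong_C_mul`, `deletePthPowers_scale`, `deletePthPowers_C_mul`, `translate_scale`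
  (`(G(μx))(x + b) = (G(x + μb))(μx)`).
* §2 **THE TORUS OF THE CHART** `prod_pow_chartScale`: for `j ∈ S` and `q ≤ degIn S d`, with
  `λ_i = μ_i μ_j (i ∈ S ∖ j)`, `λ_i = μ_i` otherwise (hypothesis `hlam`; the torus element of the old coordinates induced by scaling
  the chart coordinates by `μ`: `x_i = x_j x_i'`), `λ^d = μ_j^q · μ^{d′}` (`d′` the chart exponent); hence
  **`chartTransform_scale`**: `chartTransform q S j (F(λx)) = μ_j^q · (chartTransform q S j F)(μx)` under
  condition (1), and **`step_scale`**: `step q S j b (F(λx), r, exc) = (μ_j^q · F′(μx), r′, exc′)` where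
  `(F′, r′, exc′) = step q S j (μ•b) (F, r, exc)` — the point `b` of the scaled chart is the point `μ•b` of the
  original chart (`μ` a unit vector); `isEquimultiplePoint_scale_iff`; `step_C_mul` (a unit factor rides along).

Part 2 (`…TorusEquivarianceCell.lean`, cell words) transports `Edge / Step0 / Step1h / Step2 / StepHP` and traps
along the torus-and-unit orbit.  Scope (honest): diagonal substitutions and unit factors only; a RULE that reads
coefficients (not only supports) need not be torus-equivariant.  [OURS · counted 0 · elementary · AI kernel work,
weaker than expert review.]  NOTHING here is a statement about resolution of singularities; resolution in
dimension `≥ 4` / characteristic `p > 0` is NOT proved by anything in this file.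
bears_on: LADDER-RESOLUTION:D157-DOOR2 (res-dim4-pi).  Host item (DR-157-C): `stmt-ResolutionOfSingularities-16155`.
-/

noncomputable section

set_option linter.dupNamespace false -- mandated namespace of this single-conjunct summit

open MvPolynomial Finset

open scoped BigOperators

namespace Summit.ResolutionOfSingularities.ResolutionOfSingularities.Theorems.PIDim4

namespace Torus

open Literature.AlgebraicGeometry.Resolution
open Literature.AlgebraicGeometry.Resolution.CentreBlowup
open Literature.AlgebraicGeometry.Resolution.Hauser2010

variable {σ : Type*} {K : Type*} [Field K] [Fintype σ] [DecidableEq σ]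

/-! ## §1 The diagonal substitution `x ↦ μx` and unit factors -/

omit [DecidableEq σ] in
/-- `x^d ↦ μ^d x^d` under `x ↦ μx`. [folklore] -/
theorem scale_monomial (μ : σ → K) (d : σ →₀ ℕ) (c : K) :
    aeval (fun i => C (μ i) * X i) (monomial d c) = monomial d (c * ∏ i, μ i ^ d i) := by
  rw [aeval_monomial, Finsupp.prod_pow, algebraMap_eq]
  have h : ∀ i, (C (μ i) * X i : MvPolynomial σ K) ^ d i = C (μ i ^ d i) * X i ^ d i := fun i => by
    rw [mul_pow, map_pow]
  simp_rw [h]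
  rw [Finset.prod_mul_distrib, ← map_prod, ← mul_assoc, ← map_mul, monomial_eq, Finsupp.prod_pow]

omit [DecidableEq σ] in
/-- **Coefficients under `x ↦ μx`**: `coeff d (F(μx)) = μ^d · coeff d F`. [folklore] -/
theorem coeff_scale (μ : σ → K) (F : MvPolynomial σ K) (d : σ →₀ ℕ) :
    coeff d (aeval (fun i => C (μ i) * X i) F) = (∏ i, μ i ^ d i) * coeff d F := by
  classical
  conv_lhs => rw [F.as_sum, map_sum]
  rw [coeff_sum]
  have h : ∀ x ∈ F.support, coeff d (aeval (fun i => C (μ i) * X i) (monomial x (coeff x F)))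
      = if x = d then (∏ i, μ i ^ d i) * coeff d F else 0 := by
    intro x _
    rw [scale_monomial, coeff_monomial]
    split_ifs with hx
    · subst hx; ring
    · rfl
  rw [Finset.sum_congr rfl h, Finset.sum_ite_eq']
  split_ifs with hd
  · rfl
  · rw [MvPolynomial.notMem_support_iff.mp hd, mul_zero]

omit [DecidableEq σ] in
/-- `μ^d ≠ 0` for a unit vector `μ`. [folklore] -/
theorem prod_pow_ne_zero {μ : σ → K} (hμ : ∀ i, μ i ≠ 0) (d : σ →₀ ℕ) : (∏ i, μ i ^ d i) ≠ 0 :=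
  Finset.prod_ne_zero_iff.mpr fun i _ => pow_ne_zero _ (hμ i)

omit [DecidableEq σ] in
/-- A unit torus element does not change the support. [folklore] -/
theorem support_scale {μ : σ → K} (hμ : ∀ i, μ i ≠ 0) (F : MvPolynomial σ K) :
    (aeval (fun i => C (μ i) * X i) F).support = F.support := by
  ext d
  rw [MvPolynomial.mem_support_iff, MvPolynomial.mem_support_iff, coeff_scale]
  exact ⟨fun h hc => h (by rw [hc, mul_zero]), fun h => mul_ne_zero (prod_pow_ne_zero hμ d) h⟩

omit [DecidableEq σ] in
/-- Hence the order along every coordinate centre is torus-invariant.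
[cite: HauserPerlega2019PRIMS, §2 (ord_P)] -/
theorem ordAlong_scale {μ : σ → K} (hμ : ∀ i, μ i ≠ 0) (S : Finset σ) (F : MvPolynomial σ K) :
    ordAlong S (aeval (fun i => C (μ i) * X i) F) = ordAlong S F := by
  unfold ordAlong; rw [support_scale hμ]

omit [Fintype σ] [DecidableEq σ] in
/-- A unit factor does not change the support. [folklore] -/
theorem support_C_mul {c : K} (hc : c ≠ 0) (F : MvPolynomial σ K) : (C c * F).support = F.support := by
  ext d
  rw [MvPolynomial.mem_support_iff, MvPolynomial.mem_support_iff, coeff_C_mul]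
  exact ⟨fun h hF => h (by rw [hF, mul_zero]), fun h => mul_ne_zero hc h⟩

omit [Fintype σ] [DecidableEq σ] in
/-- Hence the order along every coordinate centre is invariant under unit factors.
[cite: HauserPerlega2019PRIMS, §2 (ord_P)] -/
theorem ordAlong_C_mul {c : K} (hc : c ≠ 0) (S : Finset σ) (F : MvPolynomial σ K) :
    ordAlong S (C c * F) = ordAlong S F := by
  unfold ordAlong; rw [support_C_mul hc]

/-- Cleaning commutes with `x ↦ μx` (it acts monomialwise). [cite: Hauser2010, §G (cleaning)] -/
theorem deletePthPowers_scale (q : ℕ) (μ : σ → K) (P : MvPolynomial σ K) :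
    deletePthPowers q (aeval (fun i => C (μ i) * X i) P) = aeval (fun i => C (μ i) * X i) (deletePthPowers q P) := by
  ext d
  rw [coeff_deletePthPowers, coeff_scale, coeff_scale, coeff_deletePthPowers]
  split_ifs <;> simp

omit [Fintype σ] in
/-- Cleaning commutes with unit (indeed any constant) factors. [cite: Hauser2010, §G (cleaning)] -/
theorem deletePthPowers_C_mul (q : ℕ) (c : K) (P : MvPolynomial σ K) :
    deletePthPowers q (C c * P) = C c * deletePthPowers q P := by
  ext d
  rw [coeff_deletePthPowers, coeff_C_mul, coeff_C_mul, coeff_deletePthPowers]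
  split_ifs <;> simp

omit [Fintype σ] [DecidableEq σ] in
/-- **Translation under the torus**: `(G(μx))(x + b) = (G(x + μ•b))(μx)` — the point `b` of the scaled
coordinates is the point `μ•b` of the original ones. [folklore] -/
theorem translate_scale (μ : σ → K) (b : σ → K) (G : MvPolynomial σ K) :
    PointBlowup.translate b (aeval (fun i => C (μ i) * X i) G) =
      aeval (fun i => C (μ i) * X i) (PointBlowup.translate (fun i => μ i * b i) G) := by
  unfold PointBlowup.translate
  rw [← AlgHom.comp_apply, ← AlgHom.comp_apply]
  have h : (aeval fun i => (X i + C (b i) : MvPolynomial σ K)).comp (aeval fun i => C (μ i) * X i) =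
      (aeval fun i => (C (μ i) * X i : MvPolynomial σ K)).comp (aeval fun i => X i + C (μ i * b i)) :=
    MvPolynomial.algHom_ext fun i => by
      simp only [AlgHom.comp_apply, aeval_X, map_mul, aeval_C, algebraMap_eq, map_add]
      ring
  exact DFunLike.congr_fun h G

/-! ## §2 The torus of the chart and the step -/

/-- **THE TORUS OF THE CHART on exponents**: `λ^d = μ_j^q · μ^{d′}` for `j ∈ S`, `q ≤ degIn S d`, `d′` the chart
exponent (`d′_j = degIn S d − q`, `d′_i = d_i`). [cite: HauserPerlega2019PRIMS, §2 (the blowup in the x₁-chart)] -/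
theorem prod_pow_chartScale {q : ℕ} {S : Finset σ} {j : σ} (hj : j ∈ S) (μ lam : σ → K)
    (hlam : ∀ i, lam i = if i ∈ S ∧ i ≠ j then μ i * μ j else μ i) {d : σ →₀ ℕ} (hd : q ≤ degIn S d) :
    (∏ i, lam i ^ d i) = μ j ^ q * ∏ i, μ i ^ (chartExponent q S j d) i := by
  -- off `j`: `λ_i^{d_i} = μ_i^{d′_i} · μ_j^{[i ∈ S] d_i}`
  have hterm : ∀ i ∈ Finset.univ.erase j,
      lam i ^ d i = μ i ^ (chartExponent q S j d) i * μ j ^ (if i ∈ S then d i else 0) := by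
    intro i hi
    have hij : i ≠ j := Finset.ne_of_mem_erase hi
    rw [chartExponent_apply_of_ne q S hij, hlam i]
    by_cases hiS : i ∈ S
    · rw [if_pos ⟨hiS, hij⟩, if_pos hiS, mul_pow]
    · rw [if_neg (fun h => hiS h.1), if_neg hiS, pow_zero, mul_one]
  have hlamj : lam j = μ j := by rw [hlam j, if_neg (fun h => h.2 rfl)]
  -- the exponents of `μ_j` collected off `j` sum to `degIn (S ∖ j) d`
  have hsum : ∑ i ∈ Finset.univ.erase j, (if i ∈ S then d i else 0) = degIn (S.erase j) d := by
    rw [← Finset.sum_filter]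
    have hfil : (Finset.univ.erase j).filter (fun i => i ∈ S) = S.erase j := by
      ext i
      rw [Finset.mem_filter, Finset.mem_erase, Finset.mem_erase]
      exact ⟨fun h => ⟨h.1.1, h.2⟩, fun h => ⟨⟨h.1, Finset.mem_univ _⟩, h.2⟩⟩
    rw [hfil]; rfl
  have hsplit := Perm2Bound.degIn_eq_add_degIn_erase hj d
  rw [← Finset.mul_prod_erase Finset.univ _ (Finset.mem_univ j),
    ← Finset.mul_prod_erase Finset.univ (fun i => μ i ^ (chartExponent q S j d) i) (Finset.mem_univ j),
    Finset.prod_congr rfl hterm, Finset.prod_mul_distrib, Finset.prod_pow_eq_pow_sum, hsum,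
    chartExponent_apply_self, hlamj]
  -- `μ_j^{d_j} · (P · μ_j^{deg'}) = μ_j^q · (μ_j^{degIn S d − q} · P)`
  have hexp : d j + degIn (S.erase j) d = q + (degIn S d - q) := by omega
  calc μ j ^ d j * ((∏ i ∈ Finset.univ.erase j, μ i ^ (chartExponent q S j d) i) * μ j ^ degIn (S.erase j) d)
      = μ j ^ (d j + degIn (S.erase j) d) * ∏ i ∈ Finset.univ.erase j, μ i ^ (chartExponent q S j d) i := by
        rw [pow_add]; ring
    _ = μ j ^ q * (μ j ^ (degIn S d - q) * ∏ i ∈ Finset.univ.erase j, μ i ^ (chartExponent q S j d) i) := by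
        rw [hexp, pow_add, mul_assoc]

/-- **THE CHART TRANSFORM UNDER THE TORUS** (condition (1): `j ∈ S`, `q ≤ degIn S d` on the support):
`chartTransform q S j (F(λx)) = μ_j^q · (chartTransform q S j F)(μx)`.
[cite: HauserPerlega2019PRIMS, §2 (the blowup in the x₁-chart)] -/
theorem chartTransform_scale {q : ℕ} {S : Finset σ} {j : σ} (hj : j ∈ S) (μ lam : σ → K)
    (hlam : ∀ i, lam i = if i ∈ S ∧ i ≠ j then μ i * μ j else μ i)
    {F : MvPolynomial σ K} (hq : ∀ d ∈ F.support, q ≤ degIn S d) :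
    chartTransform q S j (aeval (fun i => C (lam i) * X i) F) =
      C (μ j ^ q) * aeval (fun i => C (μ i) * X i) (chartTransform q S j F) := by
  have hsub : (aeval (fun i => C (lam i) * X i) F).support ⊆ F.support := by
    intro d hd
    rw [MvPolynomial.mem_support_iff, coeff_scale] at hd
    exact MvPolynomial.mem_support_iff.mpr fun h => hd (by rw [h, mul_zero])
  rw [chartTransform_eq_sum_of_subset q S j _ hsub]
  unfold chartTransform
  rw [map_sum, Finset.mul_sum]
  refine Finset.sum_congr rfl fun d hd => ?_
  rw [coeff_scale, scale_monomial, C_mul_monomial, prod_pow_chartScale hj μ lam hlam (hq d hd)]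
  congr 1
  ring

/-- The transform seen at the chart point under the torus: with the state `(F(λx), r, exc)` and the point `b`,
`pointTransform = μ_j^q · (pointTransform of (F, r, exc) at the point μ•b)(μx)`.
[cite: HauserPerlega2019PRIMS, §2 (the blowup in the x₁-chart)] -/
theorem pointTransform_scale {q : ℕ} {S : Finset σ} {j : σ} (hj : j ∈ S) (μ lam : σ → K)
    (hlam : ∀ i, lam i = if i ∈ S ∧ i ≠ j then μ i * μ j else μ i) (b : σ → K)
    (s : CState σ K) (hq : ∀ d ∈ s.F.support, q ≤ degIn S d) :
    pointTransform q S j b ⟨aeval (fun i => C (lam i) * X i) s.F, s.r, s.exc⟩ =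
      C (μ j ^ q) * aeval (fun i => C (μ i) * X i) (pointTransform q S j (fun i => μ i * b i) s) := by
  unfold pointTransform
  rw [chartTransform_scale hj μ lam hlam hq, PointBlowup.translate_C_mul, translate_scale]

omit [Fintype σ] [DecidableEq σ] in
/-- At a unit torus element the zero pattern of the chart point is unchanged. [folklore] -/
theorem mul_eq_zero_iff_of_ne {μ : σ → K} (hμ : ∀ i, μ i ≠ 0) (b : σ → K) (i : σ) :
    μ i * b i = 0 ↔ b i = 0 := by
  rw [mul_eq_zero, or_iff_right (hμ i)]

/-- **THE STEP UNDER THE TORUS**: for a unit vector `μ`, `j ∈ S` and condition (1),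
`step q S j b (F(λx), r, exc) = (μ_j^q · F′(μx), r′, exc′)` with `(F′, r′, exc′) = step q S j (μ•b) (F, r, exc)` —
the scaled state's step at `b` is the original step at `μ•b`, scaled by the torus of the chart and a unit.
[cite: Hauser2010, §§F–G (blowup followed by cleaning)] [cite: HauserPerlega2019PRIMS, §2] -/
theorem step_scale [DecidableEq K] {q : ℕ} {S : Finset σ} {j : σ} (hj : j ∈ S) {μ : σ → K}
    (hμ : ∀ i, μ i ≠ 0) (lam : σ → K) (hlam : ∀ i, lam i = if i ∈ S ∧ i ≠ j then μ i * μ j else μ i)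
    (b : σ → K) (s : CState σ K) (hq : ∀ d ∈ s.F.support, q ≤ degIn S d) :
    CentreBlowup.step q S j b ⟨aeval (fun i => C (lam i) * X i) s.F, s.r, s.exc⟩ =
      ⟨C (μ j ^ q) * aeval (fun i => C (μ i) * X i) (CentreBlowup.step q S j (fun i => μ i * b i) s).F,
        (CentreBlowup.step q S j (fun i => μ i * b i) s).r, (CentreBlowup.step q S j (fun i => μ i * b i) s).exc⟩ := by
  have hlam0 : ∀ i, lam i ≠ 0 := fun i => by
    rw [hlam i]
    split_ifs
    · exact mul_ne_zero (hμ i) (hμ j)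
    · exact hμ i
  have hfil : (s.r.filter fun i => b i = 0) = s.r.filter fun i => μ i * b i = 0 := by
    ext i
    rw [Finsupp.filter_apply, Finsupp.filter_apply]
    by_cases hb : b i = 0
    · rw [if_pos hb, if_pos ((mul_eq_zero_iff_of_ne hμ b i).mpr hb)]
    · rw [if_neg hb, if_neg (fun h => hb ((mul_eq_zero_iff_of_ne hμ b i).mp h))]
  have hexc : (s.exc.filter fun i => b i = 0) = s.exc.filter fun i => μ i * b i = 0 :=
    Finset.filter_congr fun i _ => (mul_eq_zero_iff_of_ne hμ b i).symm
  show (⟨deletePthPowers q (pointTransform q S j b ⟨_, s.r, s.exc⟩), newMult q S j b ⟨_, s.r, s.exc⟩,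
      newExc j b ⟨_, s.r, s.exc⟩⟩ : CState σ K) =
    ⟨C (μ j ^ q) * aeval (fun i => C (μ i) * X i) (deletePthPowers q (pointTransform q S j (fun i => μ i * b i) s)),
      newMult q S j (fun i => μ i * b i) s, newExc j (fun i => μ i * b i) s⟩
  rw [pointTransform_scale hj μ lam hlam b s hq, deletePthPowers_C_mul, deletePthPowers_scale]
  unfold newMult newExc
  rw [ordAlong_scale hlam0, hfil, hexc]

/-- **Equimultiplicity under the torus**: the point `b` of the scaled chart is equimultiple for `(F(λx), r, exc)`
iff the point `μ•b` is for `(F, r, exc)` (unit `μ`, `j ∈ S`, condition (1)). [cite: Hauser2010, §F (equiconstant points)] -/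
theorem isEquimultiplePoint_scale_iff {q : ℕ} {S : Finset σ} {j : σ} (hj : j ∈ S) {μ : σ → K}
    (hμ : ∀ i, μ i ≠ 0) (lam : σ → K) (hlam : ∀ i, lam i = if i ∈ S ∧ i ≠ j then μ i * μ j else μ i)
    (b : σ → K) (s : CState σ K) (hq : ∀ d ∈ s.F.support, q ≤ degIn S d) :
    IsEquimultiplePoint q S j b ⟨aeval (fun i => C (lam i) * X i) s.F, s.r, s.exc⟩ ↔
      IsEquimultiplePoint q S j (fun i => μ i * b i) s := by
  unfold IsEquimultiplePoint
  rw [pointTransform_scale hj μ lam hlam b s hq]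
  refine forall_congr' fun d => forall_congr' fun _ => forall_congr' fun _ => ?_
  rw [coeff_C_mul, coeff_scale, mul_eq_zero, mul_eq_zero, or_iff_right (pow_ne_zero _ (hμ j)),
    or_iff_right (prod_pow_ne_zero hμ d)]

omit [Fintype σ] in
/-- **A unit factor rides along the step**: `step q S j b (c·F, r, exc) = (c·F′, r′, exc′)`. [folklore] -/
theorem step_C_mul [DecidableEq K] (q : ℕ) (S : Finset σ) (j : σ) {c : K} (hc : c ≠ 0) (b : σ → K)
    (F : MvPolynomial σ K) (r : σ →₀ ℕ) (exc : Finset σ) :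
    CentreBlowup.step q S j b ⟨C c * F, r, exc⟩ =
      ⟨C c * (CentreBlowup.step q S j b ⟨F, r, exc⟩).F, (CentreBlowup.step q S j b ⟨F, r, exc⟩).r,
        (CentreBlowup.step q S j b ⟨F, r, exc⟩).exc⟩ := by
  show (⟨deletePthPowers q (PointBlowup.translate b (chartTransform q S j (C c * F))),
      newMult q S j b ⟨C c * F, r, exc⟩, newExc j b ⟨C c * F, r, exc⟩⟩ : CState σ K) =
    ⟨C c * deletePthPowers q (PointBlowup.translate b (chartTransform q S j F)), newMult q S j b ⟨F, r, exc⟩,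
      newExc j b ⟨F, r, exc⟩⟩
  rw [chartTransform_C_mul, PointBlowup.translate_C_mul, deletePthPowers_C_mul]
  unfold newMult
  rw [ordAlong_C_mul hc]
  rfl

omit [Fintype σ] in
/-- Equimultiplicity is invariant under a unit factor. [folklore] -/
theorem isEquimultiplePoint_C_mul_iff (q : ℕ) (S : Finset σ) (j : σ) {c : K} (hc : c ≠ 0) (b : σ → K)
    (F : MvPolynomial σ K) (r : σ →₀ ℕ) (exc : Finset σ) :
    IsEquimultiplePoint q S j b ⟨C c * F, r, exc⟩ ↔ IsEquimultiplePoint q S j b ⟨F, r, exc⟩ := by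
  unfold IsEquimultiplePoint pointTransform
  show (∀ d : σ →₀ ℕ, d ≠ 0 → d.degree < q →
      coeff d (PointBlowup.translate b (chartTransform q S j (C c * F))) = 0) ↔
    ∀ d : σ →₀ ℕ, d ≠ 0 → d.degree < q → coeff d (PointBlowup.translate b (chartTransform q S j F)) = 0
  rw [chartTransform_C_mul, PointBlowup.translate_C_mul]
  refine forall_congr' fun d => forall_congr' fun _ => forall_congr' fun _ => ?_
  rw [coeff_C_mul, mul_eq_zero, or_iff_right hc]

end Torus

end Summit.ResolutionOfSingularities.ResolutionOfSingularities.Theorems.PIDim4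

end
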